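import Summits.QuantumFields.YangMills.Theorems.IR.AfPincerUcSharpOnset
import Summits.QuantumFields.YangMills.Theorems.IR.CollarDecouplingCriterion
import Summits.QuantumFields.YangMills.Theorems.IR.CollarDecouplingRungSC
import HarnessLib

/-!
# Crux `IR` (stmt-QuantumFields-19354) — line `collar-decoupling` (ideator ym-ir-idea-5, lens: RP transfer-matrix bounds)

FORMAT OF THIS LINE.  The transfer-matrix norm bound `‖T̂ᵇ|_{Ω^⊥}‖ = ρ_max(past, future at gap b)` (Hirschfeld–Gebelein–Rényi
maximal correlation of the two half-spaces = the slice contraction) is moved from HALF-SPACES to CUBICAL COLLARS of the periodic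
torus: `CollarDecouplingAt ρ β b` says that on every odd torus `(2S+1)⁴` and for every cube `Λ_R(c)` with `R + b + 2 ≤ S`, every
bounded cube-local statistic `f` has an `L²(μ)`-surrogate `f'` which (a) is orthogonal-equivalent to `f` against every bounded
statistic of the exterior of `Λ_{R+b}(c)`, (b) is local in `Λ_{R+b+2}(c)` (Markov localisation of the conditional expectation),
(c) has variance at most `¼ · Var f` (maximal correlation across the collar `≤ ½`).  No boundary datum, no typicality predicate,
no transfer matrix, no thermal face: an `L²(μ)` operator-norm certificate at ONE mesh `b`.

* `CollarCriterion` (E-seam, stub 1; provable now, size M/L): nested-collar submultiplicativity — iterating (a)–(c) over the cubes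
  `Λ_{R₀ + k(b+2)}` around `supp A` and closing with Cauchy–Schwarz gives `|corr_{2S+1}(A, τ_t B)| ≤ C(A,B)·2^{-⌊t/(b+2)⌋}`, i.e. the
  generic clustering contract `AfPincerUc.FmtClustering` at rate `κ / b`, constants uniform in `β, b, S`.
* `CollarSharpOnset` (the load, stub 2): for every compact simple `G`, every `r`, every positive unit `a → 0` with `LowerBounds`,
  for all large `β` the collar format holds at SOME mesh `b < T / a(β)` («L²-decoupling across collars of bounded physical width»).
* `IR_of : CollarCriterion → CollarSharpOnset → Theses.BalabanLadder.IR` — real proof through the landed generic pincer seams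
  `AfPincerUc.gapInUnits_of_fmtOnset` / `fmtOnset_le` (Theorems/IR/AfPincerUcFormat.lean).

**RE-BASED v2 (LEAD ym-ir-line-mxc-p1 g4, 2026-08-28; merged line «maximal correlation at one physical thickness», director-ym
R363 — this collar typing was merged into `Lines/shell_maxcorr_doubling.lean`'s line; NOT a registry write):** §1–§2's vocabulary
(`cubeSites`, `cubeEdges`, `IsCubeLocal`, `IsExteriorLocal`, `CollarDecouplingAt`) and the E-seam statement `CollarCriterion` are the
tree constants of `Theorems/IR/ShellMaxCorrDefs.lean` §0 (same namespace, verbatim bodies; p587133), `CollarRungSC` is the tree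
constant of `Theorems/IR/CollarDecouplingRungSC.lean` §0 — all imported instead of re-declared; STUB 0 `stub_collarRungSC` is the
tree theorem of `Theorems/IR/CollarDecouplingRungSC.lean` (LEAD g3, p610100: W-generic strong-coupling kernel-average surrogate,
Var ≤ ¼ Var at `0 < β ≤ β_D`, DLR-orthogonal, local in `Λ_{R+5}(c)`), STUB 1 `stub_collarCriterion` is the tree theorem of
`Theorems/IR/CollarDecouplingCriterion.lean` (LEAD, p590240: nested-collar submultiplicativity + Cauchy–Schwarz).  Open after v2:
ONLY the XL load `stub_collarSharpOnset` (unstaffed per R366 (i)); the composition `IR_of_stubs` is kernel-checked modulo that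
one `sorry`.  Bridge to the shell load: `Theorems/IR/ShellMaxCorrCollarBridge.lean` (`CollarDecouplingAt ρ β b → ShellCert ρ β S (b+2) (1/2)`,
`shellCertificate_of_collarOnset`), so `CollarSharpOnset → IRShellCorr`-direction transfers are by name.

HONEST FRAMING: a typed skeleton for ONE open gap-crux of a CONDITIONAL chain (Track A UV rung `BalabanLadder.UV` is what R4 closes, on
finite 𝕋⁴ only); the load stub is OPEN; nothing here proves weak-coupling decoupling, a lattice mass gap, or the Clay problem.
**COFINAL RE-CUT (LEAD mxc-p1 g5, v3; director-ym №25 (2), leaf re-typed to `Theses.BalabanLadder.IRcof`, stmt-QuantumFields-26930):** WALL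
UNCHANGED — cofinal load `CollarDecoupling.CollarOnsetCof` (typed in `Lines/shell_maxcorr_doubling_cofinal.lean` §2) ⇒ `ShellMaxCorr.IRShellCorrCof`
per coupling (`ShellMaxCorr.shellCertOn_of_collarOnsetOn`) ⇒ `IRcof` by name (`ShellMaxCorr.ircof_of_collarOnsetCof`; both p618715
`Theorems/IR/ShellMaxCorrCofinalEngine.lean`).  THIS file (old leaf `IR`, load `stub_collarSharpOnset`) is unchanged below.
-/

set_option autoImplicit false

noncomputable section

open Filter Topology MeasureTheory
open scoped SchwartzMap
open Literature.MathematicalPhysics.QuantumFieldTheory Literature.MathematicalPhysics.QuantumLattice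
open Summit.QuantumFields.YangMills.Cruxes.OSLegsFromFemtoAndGap.DlrCollarTransfer (GapInUnits LowerBounds Q2)
open Summit.QuantumFields.YangMills.Cruxes.IR.AfPincerUc (fmtSet fmtOnset fmtOnset_spec fmtOnset_le FmtClustering
  gapInUnits_of_fmtOnset IRCal)

namespace Summit.QuantumFields.YangMills.Cruxes.IR.CollarDecoupling

/-! ## §1–§2 Vocabulary and format: RE-BASED onto `Theorems/IR/ShellMaxCorrDefs.lean` §0 (imported)

`cubeSites`, `cubeEdges`, `IsCubeLocal`, `IsExteriorLocal`, `CollarDecouplingAt`, `CollarCriterion` (and `CollarRungSC` from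
`Theorems/IR/CollarDecouplingRungSC.lean`) are tree constants of this namespace; nothing is re-declared here. -/

variable {G : Type} [Group G] [TopologicalSpace G] [IsTopologicalGroup G] [CompactSpace G]
  [MeasurableSpace G] [BorelSpace G]

/-! ## §3 The stubs -/

-- STUB 0 (the rung) `stub_collarRungSC : CollarRungSC`: LANDED (LEAD g3, p610100, `Theorems/IR/CollarDecouplingRungSC.lean`), imported.
example : CollarRungSC := stub_collarRungSC

-- STUB 1 (E-seam) `stub_collarCriterion : CollarCriterion`: LANDED (LEAD, p590240, `Theorems/IR/CollarDecouplingCriterion.lean`), imported.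
example : CollarCriterion := stub_collarCriterion

/-- **The load (sharp onset form): collar decoupling across collars of bounded physical width.**  For every compact simple `G`,
every lattice representation `r`, every positive unit `a → 0` with `LowerBounds G r a`: for all large `β` the collar format holds at
some mesh `b ≥ 1` with `a β · b < T`. -/
def CollarSharpOnset : Prop :=
  ∀ (G : Type) [Group G] [TopologicalSpace G] [IsTopologicalGroup G] [CompactSpace G],
    IsCompactSimpleLieGroup G → letI : MeasurableSpace G := borel G; haveI : BorelSpace G := ⟨rfl⟩;
    ∀ (r : LatticeRep G) (a : ℝ → ℝ), (∀ β, 0 < a β) → Tendsto a atTop (𝓝 0) → LowerBounds G r a →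
      ∃ T β₂ : ℝ, ∀ β : ℝ, β₂ ≤ β → ∃ b : ℕ, 1 ≤ b ∧ a β * (b : ℝ) < T ∧ CollarDecouplingAt r.ρ β b

/-- STUB 2 (the load; size XL; the crux of the line). -/
theorem stub_collarSharpOnset : CollarSharpOnset := by
  sorry

/-! ## §4 Kernel-checked composition to the route decl -/

/-- The criterion is a clustering contract for the collar format at every `(G, r)` (bookkeeping). -/
theorem fmtClustering_of_collarCriterion (hE : CollarCriterion) (r : LatticeRep G) :
    ∃ (κ : ℝ) (s₀ : ℕ), 0 < κ ∧ FmtClustering r (fun β b => CollarDecouplingAt r.ρ β b) κ s₀ := by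
  obtain ⟨κ, s₀, hκ, hF⟩ := hE
  refine ⟨κ, s₀, hκ, fun A B => ?_⟩
  obtain ⟨C, hC⟩ := hF G r.N r.ρ r.continuous A B
  exact ⟨C, fun β b hb hP S hS t ht => hC β b hb hP S hS t ht⟩

omit [MeasurableSpace G] [BorelSpace G] in
/-- **E ∧ load ⇒ `IRCal`** (the verbatim body of the route decl), through the landed generic pincer. -/
theorem irCal_of_collar (hE : CollarCriterion) (hS : CollarSharpOnset) : IRCal := by
  intro G _ _ _ _ hG
  letI : MeasurableSpace G := borel G
  haveI : BorelSpace G := ⟨rfl⟩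
  intro r a ha hat hlb
  obtain ⟨κ, s₀, hκ, hcl⟩ := fmtClustering_of_collarCriterion hE r
  obtain ⟨T, β₂, hb⟩ := hS G hG r a ha hat hlb
  refine gapInUnits_of_fmtOnset r a ha hκ hcl (β₂ := β₂) (T := T) (β₆ := β₂) ?_ ?_
  · intro β hβ
    obtain ⟨b, hb1, -, hP⟩ := hb β hβ
    exact ⟨b, hb1, hP⟩
  · intro β hβ
    obtain ⟨b, hb1, hlt, hP⟩ := hb β hβ
    have hle : fmtOnset (fun β' b => CollarDecouplingAt r.ρ β' b) β ≤ b :=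
      fmtOnset_le (fun β' b => CollarDecouplingAt r.ρ β' b) β hb1 hP
    have hle' : (fmtOnset (fun β' b => CollarDecouplingAt r.ρ β' b) β : ℝ) ≤ (b : ℝ) := by
      exact_mod_cast hle
    calc a β * (fmtOnset (fun β' b => CollarDecouplingAt r.ρ β' b) β : ℝ) ≤ a β * (b : ℝ) := by
          gcongr; exact (ha β).le
      _ < T := hlt

omit [MeasurableSpace G] [BorelSpace G] in
/-- **COMPOSITION (real proof): `CollarCriterion → CollarSharpOnset → BalabanLadder.IR`** — the route decl BY NAME. -/
theorem IR_of (hE : CollarCriterion) (hS : CollarSharpOnset) :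
    Summit.QuantumFields.YangMills.Theses.BalabanLadder.IR := by
  have hI : IRCal := irCal_of_collar hE hS
  delta Summit.QuantumFields.YangMills.Theses.BalabanLadder.IR
  delta Summit.QuantumFields.YangMills.Cruxes.IR.AfPincerUc.IRCal at hI
  exact hI

/-- The registered stubs close the crux (kernel-checked modulo the ONE `sorry` above — the XL load). -/
theorem IR_of_stubs : Summit.QuantumFields.YangMills.Theses.BalabanLadder.IR :=
  IR_of stub_collarCriterion stub_collarSharpOnset

end Summit.QuantumFields.YangMills.Cruxes.IR.CollarDecoupling

end
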